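import Literature.NumberTheory.EllipticCurves.PAdicGrossZagierConstantTermProofs
import Literature.NumberTheory.EllipticCurves.OpenImageMazurTwistProofs
import Literature.NumberTheory.EllipticCurves.BSDInvariantsProofs
import Literature.NumberTheory.EllipticCurves.SelmerCorankProofs
import Literature.NumberTheory.EllipticCurves.GaloisActionProofs
import HarnessLib

/-!
# BirchSwinnertonDyer — crux `UBPotentiallyGood` (stmt-BirchSwinnertonDyer-15878), line `Sketch`,
# stub `stub_twistAdmissible`: admissibility is stable under quadratic twists

Stub **ADM** of line `Sketch` (crux `ToricShedding.UBPotentiallyGood` = `FrozenTwin.UBPotentiallyGood`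
= `DefiniteTheta.UBPotentiallyGood`): for an elliptic curve `E/ℚ` with globally minimal equation
`W`, a prime `p ≥ 5` of good reduction with `p ∤ a_p(E)` and surjective mod-`p` representation
`ρ̄_{E,p} : Γ_ℚ → Aut(E[p])`, and an integer `d ≠ 0` with `p ∤ d`, the quadratic twist
`E^{(d)} = W.quadraticTwist d` has a global minimal model `W' = C • W^{(d)}` (Néron; tree theorem
`hasGlobalMinimalModel_rat_holds`) which is again

* of good reduction at `p`: the twisted equation is `p`-integral with `p`-unit discriminant
  `d⁶ Δ_min(W)` (`hasGoodReductionAt_quadraticTwist`, Silverman *AEC* VII.1 Remark 1.1), and good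
  reduction is an isomorphism invariant (`hasGoodReductionAt_smul_iff_holds`);
* ordinary at `p`: writing `d = d₀ b²` with `d₀` squarefree, `W' ≅ W^{(d₀)}` over `ℚ`
  (`exists_variableChange_quadraticTwist_mul_sq`) and `a_p(W') = (d₀/p) a_p(W)` with `(d₀/p) = ±1`
  (`frobeniusTrace_quadraticTwist_holds`, Knapp Prop. 12.10);
* of surjective mod-`p` representation: `E'(ℚ̄) ≃ E(ℚ̄)` equivariantly up to the sign
  `σ√d/√d` (`exists_addEquiv_geomPoints_quadraticTwist_signed`, Silverman *AEC* X.2 Prop. 2.4,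
  X.5 Cor. 5.4), i.e. `ρ̄_{E',p} ≅ ρ̄_{E,p} ⊗ χ_d`; since `-1 = J²` is a square in
  `Aut(E[p]) ≅ GL₂(𝔽_p)` (`J = (0 -1; 1 0)` in a frame `E[p] ≅ 𝔽_p²`, `#E[p] = p²` by
  `card_torsionPoints_eq_sq_holds`), the element `γ²` (`ρ̄_{E,p}(γ) = J`) lies in `Γ_{ℚ(√d)}` up to
  the character and acts as `-1`, so the image of `ρ̄_{E',p} = χ_d ⊗ ρ̄_{E,p}` contains `-1` and
  hence everything (`twistAdmissible_surjective_toAddAut_of_signEquivariant`, elementary group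
  theory).

The main theorem `stub_twistAdmissible` is the registered stub signature verbatim.

References: J. H. Silverman, *The Arithmetic of Elliptic Curves*, 2nd ed. (2009), VII.1, VIII.8,
X.2 Prop. 2.4, X.5 Cor. 5.4; A. W. Knapp, *Elliptic Curves* (1993), Prop. 12.10; K. Rubin,
A. Silverberg, *Ranks of elliptic curves*, Bull. AMS 39 (2002), §1; J.-P. Serre, Invent. Math. 15
(1972), §4.
-/

-- D-0017: single-problem summit, so `Summit.BirchSwinnertonDyer.BirchSwinnertonDyer.…` repeats a
-- namespace BY DESIGN.
set_option linter.dupNamespace false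

noncomputable section

open scoped Classical

namespace Summit.BirchSwinnertonDyer.BirchSwinnertonDyer.Theorems

open Literature.NumberTheory.EllipticCurves WeierstrassCurve NumberField IsDedekindDomain

/-! ### Group theory: surjectivity through a sign-twisted isomorphism -/

/-- **Surjectivity of a `G`-action transported through a sign-twisted isomorphism.** Let `G` act
on abelian groups `A`, `B`, let `e : A ≃+ B` satisfy, for every `σ ∈ G`, either `e(σa) = σ e(a)`
for all `a` or `e(σa) = -σ e(a)` for all `a` (the action on `A` is the action on `B` twisted by a
sign), and suppose `-1 = g ∘ g` is a square in `Aut(B)`. If `G → Aut(B)` is onto, so is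
`G → Aut(A)`: with `γ ↦ g`, `γ²` acts as `-1` on `A`, and for `σ ↦ e f e⁻¹` either `σ` or `σγ²`
acts as `f` on `A`. (The case `GL₂(𝔽_p)`, `g = (0 -1; 1 0)`: Serre 1972, §4.) [folklore] -/
theorem twistAdmissible_surjective_toAddAut_of_signEquivariant
    {G A B : Type*} [Group G] [AddCommGroup A] [AddCommGroup B]
    [DistribMulAction G A] [DistribMulAction G B] (e : A ≃+ B)
    (he : ∀ σ : G, (∀ a, e (σ • a) = σ • e a) ∨ (∀ a, e (σ • a) = -(σ • e a)))
    (g : B ≃+ B) (hg : ∀ b, g (g b) = -b)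
    (hB : Function.Surjective (DistribMulAction.toAddAut G B)) :
    Function.Surjective (DistribMulAction.toAddAut G A) := by
  have happ : ∀ (σ : G) (b : B),
      Multiplicative.toAdd (DistribMulAction.toAddAut G B σ) b = σ • b := fun _ _ ↦ rfl
  have happA : ∀ (σ : G) (a : A),
      Multiplicative.toAdd (DistribMulAction.toAddAut G A σ) a = σ • a := fun _ _ ↦ rfl
  -- `γ ↦ g`, so `γ²` acts as `-1` on `A`
  obtain ⟨γ, hγ⟩ := hB (Multiplicative.ofAdd g)
  have hγ' : ∀ b : B, γ • b = g b := fun b ↦ by rw [← happ, hγ, toAdd_ofAdd]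
  have hτ : ∀ a : A, (γ * γ) • a = -a := fun a ↦ e.injective <| by
    rw [map_neg, mul_smul]
    rcases he γ with h | h
    · rw [h, h, hγ', hγ', hg]
    · rw [h, h, smul_neg, neg_neg, hγ', hγ', hg]
  intro f
  obtain ⟨σ, hσ⟩ := hB (Multiplicative.ofAdd (e.symm.trans ((Multiplicative.toAdd f).trans e)))
  have hσ' : ∀ b : B, σ • b = e (Multiplicative.toAdd f (e.symm b)) := fun b ↦ by
    rw [← happ, hσ, toAdd_ofAdd]; rfl
  rcases he σ with hs | hs
  · refine ⟨σ, ?_⟩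
    apply Multiplicative.toAdd.injective
    refine AddEquiv.ext fun a ↦ e.injective ?_
    rw [happA, hs, hσ', e.symm_apply_apply]
  · refine ⟨σ * (γ * γ), ?_⟩
    apply Multiplicative.toAdd.injective
    refine AddEquiv.ext fun a ↦ e.injective ?_
    rw [happA, mul_smul, hτ, smul_neg, map_neg, hs, neg_neg, hσ', e.symm_apply_apply]

/-! ### `-1` is a square in `Aut(E[p])` -/

/-- The quarter turn `J = (0 -1; 1 0)` on `R²`: an additive automorphism with `J ∘ J = -1`.
[folklore] -/
theorem twistAdmissible_exists_quarterTurn (R : Type*) [AddCommGroup R] :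
    ∃ J : (Fin 2 → R) ≃+ (Fin 2 → R), ∀ v, J (J v) = -v :=
  ⟨{ toFun := fun v ↦ ![-v 1, v 0]
     invFun := fun v ↦ ![v 1, -v 0]
     left_inv := fun v ↦ by ext i; fin_cases i <;> simp
     right_inv := fun v ↦ by ext i; fin_cases i <;> simp
     map_add' := fun v w ↦ by ext i; fin_cases i <;> simp [add_comm] },
    fun v ↦ by ext i; fin_cases i <;> simp⟩

/-- **`-1` is a square in `Aut(E[p])`**: for an elliptic curve `W/ℚ` and a prime `p` there is an
additive automorphism `g` of `E[p] = E(ℚ̄)[p]` with `g ∘ g = -1` — in a frame `E[p] ≅ 𝔽_p²`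
(`#E[p] = p²`, `card_torsionPoints_eq_sq_holds`, Silverman *AEC* III.6.4(b)) take the quarter
turn `(0 -1; 1 0)`. [cite: SilvermanAEC2009, Cor. III.6.4(b)] -/
theorem twistAdmissible_exists_sq_eq_neg (W : WeierstrassCurve ℚ) [W.IsElliptic] (p : ℕ)
    [Fact p.Prime] : ∃ g : geomTorsion W p ≃+ geomTorsion W p, ∀ P, g (g P) = -P := by
  letI : Module (ZMod p) (geomTorsion W p) := AddSubgroup.torsionBy.zmodModule
  have hp : p.Prime := Fact.out
  have hpF : ((p : ℕ) : AlgebraicClosure ℚ) ≠ 0 := by exact_mod_cast hp.ne_zero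
  have hcard : Nat.card (geomTorsion W p) = p ^ 2 :=
    card_torsionPoints_eq_sq_holds W (AlgebraicClosure ℚ) hpF
  haveI : Finite (geomTorsion W p) :=
    Nat.finite_of_card_ne_zero (by rw [hcard]; exact pow_ne_zero _ hp.ne_zero)
  haveI : Module.Finite (ZMod p) (geomTorsion W p) := Module.Finite.of_finite
  have hrank : Module.finrank (ZMod p) (geomTorsion W p) = 2 := by
    have h := Module.natCard_eq_pow_finrank (K := ZMod p) (V := geomTorsion W p)
    rw [hcard, Nat.card_zmod] at h
    exact (Nat.pow_right_injective hp.two_le h).symm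
  let e : geomTorsion W p ≃+ (Fin 2 → ZMod p) :=
    (Module.finBasisOfFinrankEq (ZMod p) (geomTorsion W p) hrank).equivFun.toAddEquiv
  obtain ⟨J, hJ⟩ := twistAdmissible_exists_quarterTurn (ZMod p)
  refine ⟨e.trans (J.trans e.symm), fun P ↦ ?_⟩
  simp only [AddEquiv.trans_apply, AddEquiv.apply_symm_apply, hJ, map_neg,
    AddEquiv.symm_apply_apply]

/-! ### Surjectivity of `ρ̄_{E,p}` through a sign-twisted isomorphism of curves -/

/-- **Surjectivity of the mod-`p` representation is invariant under twisting by a quadratic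
character.** If `f : E₁(ℚ̄) ≃+ E₂(ℚ̄)` is additive and, for every `σ ∈ Γ_ℚ`, either
`Γ_ℚ`-equivariant or anti-equivariant at `σ` (`f(σP) = ±σ f(P)`), then `ρ̄_{E₂,p}` onto implies
`ρ̄_{E₁,p}` onto (`E₂` elliptic): restrict `f` to `E₁[p] ≃+ E₂[p]` and apply
`twistAdmissible_surjective_toAddAut_of_signEquivariant` with `-1 = J²` in `Aut(E₂[p])`.
[cite: Serre1972, §4] -/
theorem twistAdmissible_hasSurjectiveModNGaloisRep_of_addEquiv_signed
    {W₁ W₂ : WeierstrassCurve ℚ} [W₂.IsElliptic] (f : geomPoints W₁ ≃+ geomPoints W₂)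
    (hf : ∀ σ : Field.absoluteGaloisGroup ℚ,
      (∀ P, f (σ • P) = σ • f P) ∨ (∀ P, f (σ • P) = -(σ • f P)))
    (p : ℕ) [Fact p.Prime] (h : W₂.HasSurjectiveModNGaloisRep p) :
    W₁.HasSurjectiveModNGaloisRep p := by
  obtain ⟨g, hg⟩ := twistAdmissible_exists_sq_eq_neg W₂ p
  let e : geomTorsion W₁ p ≃+ geomTorsion W₂ p := torsionByEquiv f p
  have he : ∀ P : geomTorsion W₁ p, ((e P : geomTorsion W₂ p) : geomPoints W₂) = f P :=
    fun _ ↦ rfl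
  refine twistAdmissible_surjective_toAddAut_of_signEquivariant e (fun σ ↦ ?_) g hg h
  rcases hf σ with hs | hs
  · left
    intro P
    apply Subtype.ext
    rw [he, AddSubgroup.torsionBy.coe_smul, hs, AddSubgroup.torsionBy.coe_smul, he]
  · right
    intro P
    apply Subtype.ext
    rw [he, AddSubgroup.torsionBy.coe_smul, hs, AddSubgroup.coe_neg,
      AddSubgroup.torsionBy.coe_smul, he]

/-- **`ρ̄_{E^d,p}` onto from `ρ̄_{E,p}` onto**, for any model `C • W^{(d)}` of the quadratic
twist by `d ≠ 0`: `(C • W^{(d)})(ℚ̄) ≃+ W^{(d)}(ℚ̄)` is `Γ_ℚ`-equivariant (`geomPointsEquiv`,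
the change of variables is rational) and `W^{(d)}(ℚ̄) ≃+ W(ℚ̄)` is equivariant up to the sign
`σ√d/√d` (`exists_addEquiv_geomPoints_quadraticTwist_signed`, Silverman *AEC* X.2 Prop. 2.4:
`ρ̄_{E^d,p} ≅ ρ̄_{E,p} ⊗ χ_d`). [cite: SilvermanAEC2009, X.5 Cor. 5.4 and X.2 Prop. 2.4] -/
theorem twistAdmissible_hasSurjectiveModNGaloisRep_smul_quadraticTwist (W : WeierstrassCurve ℚ)
    [W.IsElliptic] {d : ℚ} (hd : d ≠ 0) (C : VariableChange ℚ) (p : ℕ) [Fact p.Prime]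
    (h : W.HasSurjectiveModNGaloisRep p) :
    (C • W.quadraticTwist d).HasSurjectiveModNGaloisRep p := by
  obtain ⟨f, hf⟩ := W.exists_addEquiv_geomPoints_quadraticTwist_signed hd
  let e₁ : geomPoints (C • W.quadraticTwist d) ≃+ geomPoints (W.quadraticTwist d) :=
    (geomPointsEquiv (W.quadraticTwist d) C).symm
  have he₁ : ∀ (σ : Field.absoluteGaloisGroup ℚ) (P : geomPoints (C • W.quadraticTwist d)),
      e₁ (σ • P) = σ • e₁ P := fun σ P ↦ by
    apply (geomPointsEquiv (W.quadraticTwist d) C).injective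
    change geomPointsEquiv (W.quadraticTwist d) C
        ((geomPointsEquiv (W.quadraticTwist d) C).symm (σ • P)) =
      geomPointsEquiv (W.quadraticTwist d) C (σ • (geomPointsEquiv (W.quadraticTwist d) C).symm P)
    rw [AddEquiv.apply_symm_apply, geomPointsEquiv_smul, AddEquiv.apply_symm_apply]
  refine twistAdmissible_hasSurjectiveModNGaloisRep_of_addEquiv_signed (e₁.trans f)
    (fun σ ↦ ?_) p h
  rcases hf σ with hs | hs
  · left
    intro P
    rw [AddEquiv.trans_apply, AddEquiv.trans_apply, he₁, hs]
  · right
    intro P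
    rw [AddEquiv.trans_apply, AddEquiv.trans_apply, he₁, hs]

/-! ### The stub -/

/-- **Stub `stub_twistAdmissible` (ADMISSIBILITY IS TWIST-STABLE).** For `E/ℚ` (globally minimal
`W`), a prime `p ≥ 5` of good reduction with `p ∤ a_p` and `ρ̄_{E,p}` surjective, and an integer
`d ≠ 0` with `p ∤ d`, the quadratic twist `E^{(d)}` has a global minimal model `C • W^{(d)}`
(Néron; `hasGlobalMinimalModel_rat_holds`) which is again of good reduction at `p` (`p ∤ 2d`:
`hasGoodReductionAt_quadraticTwist`, `hasGoodReductionAt_smul_iff_holds`), ordinary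
(`a_p(E^d) = (d₀/p)·a_p(E)` for the squarefree part `d₀` of `d = d₀ b²`,
`frobeniusTrace_quadraticTwist_holds`, `E^{(d₀ b²)} ≅ E^{(d₀)}`) and has surjective mod-`p`
representation (`ρ̄_{E^d,p} ≅ ρ̄_{E,p} ⊗ χ_d` and `-1` is a square in `Aut(E[p])`,
`twistAdmissible_hasSurjectiveModNGaloisRep_smul_quadraticTwist`). Silverman *AEC* VII.1, VIII.8,
X.2 Prop. 2.4, X.5 Cor. 5.4; Knapp Prop. 12.10; Rubin–Silverberg 2002 §1.
[cite: RubinSilverberg2002, §1] -/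
theorem stub_twistAdmissible :
    ∀ (W : WeierstrassCurve ℚ) [W.IsElliptic] [W.IsGloballyMinimal] (p : ℕ) [Fact p.Prime],
      5 ≤ p → W.HasGoodReductionAtPrime p → ¬ (p : ℤ) ∣ W.frobeniusTrace p →
        W.HasSurjectiveModNGaloisRep p → ∀ (d : ℤ), d ≠ 0 → ¬ (p : ℤ) ∣ d →
          ∃ (C : WeierstrassCurve.VariableChange ℚ)
            (_ : (C • W.quadraticTwist (d : ℚ)).IsGloballyMinimal),
            (C • W.quadraticTwist (d : ℚ)).HasGoodReductionAtPrime p ∧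
              ¬ (p : ℤ) ∣ (C • W.quadraticTwist (d : ℚ)).frobeniusTrace p ∧
                (C • W.quadraticTwist (d : ℚ)).HasSurjectiveModNGaloisRep p := by
  intro W _ _ p _ h5 hgood hord hsurj d hd hpd
  have hpP : p.Prime := Fact.out
  have hpZ : Prime (p : ℤ) := Nat.prime_iff_prime_int.mp hpP
  have hp2 : ¬ (p : ℤ) ∣ 2 := fun h ↦ by
    have := Int.le_of_dvd two_pos h
    omega
  have h2d : ¬ (p : ℤ) ∣ 2 * d := fun h ↦ (hpZ.dvd_or_dvd h).elim hp2 hpd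
  have hΔ : ¬ (p : ℤ) ∣ minimalDiscriminantInt W :=
    W.not_dvd_minimalDiscriminantInt_of_hasGoodReductionAtPrime p hgood
  -- squarefree part: `d = d₀ b²`
  obtain ⟨a, b, ha, hb, hab, hsq⟩ := Nat.sq_mul_squarefree_of_pos (Int.natAbs_pos.mpr hd)
  set d₀ : ℤ := d.sign * a with hd₀
  have hdd : d = d₀ * (b : ℤ) ^ 2 := by
    have h1 : (d.natAbs : ℤ) = (b : ℤ) ^ 2 * a := by exact_mod_cast hab.symm
    calc d = d.sign * (d.natAbs : ℤ) := (Int.sign_mul_natAbs d).symm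
      _ = d₀ * (b : ℤ) ^ 2 := by rw [h1, hd₀]; ring
  have hd₀sq : Squarefree d₀ := by
    rw [← Int.squarefree_natAbs, hd₀, Int.natAbs_mul, Int.natAbs_sign_of_ne_zero hd, one_mul,
      Int.natAbs_natCast]
    exact hsq
  have hb0 : (b : ℚ) ≠ 0 := by exact_mod_cast hb.ne'
  have hpd₀ : ¬ (p : ℤ) ∣ d₀ := fun h ↦ hpd (by rw [hdd]; exact h.mul_right _)
  have h2d₀ : ¬ (p : ℤ) ∣ 2 * d₀ := fun h ↦ (hpZ.dvd_or_dvd h).elim hp2 hpd₀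
  have hd₀p : ((d₀ : ℤ) : ZMod p) ≠ 0 := fun h ↦
    hpd₀ ((ZMod.intCast_zmod_eq_zero_iff_dvd d₀ p).mp h)
  -- the twisted model `X`, a global minimal model `C • X` of it, and `C • X ≅ W^{(d₀)}`
  set X : WeierstrassCurve ℚ := W.quadraticTwist (d : ℚ) with hX
  haveI hXell : X.IsElliptic := W.isElliptic_quadraticTwist (by exact_mod_cast hd)
  obtain ⟨C, hC⟩ := hasGlobalMinimalModel_rat_holds X
  haveI := hC
  obtain ⟨C₁, hC₁⟩ := W.exists_variableChange_quadraticTwist_mul_sq (d₀ : ℚ) (b : ℚ) hb0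
  have hXd₀ : X = C₁ • W.quadraticTwist (d₀ : ℚ) := by
    rw [hC₁, hX, hdd]; push_cast; rfl
  have hiso : ∃ C' : VariableChange ℚ, C' • (C • X) = W.quadraticTwist (d₀ : ℚ) :=
    ⟨C₁⁻¹ * C⁻¹, by rw [mul_smul, inv_smul_smul, hXd₀, inv_smul_smul]⟩
  -- good reduction of `C • X` at `p`
  obtain ⟨v, hv⟩ : ∃ v : HeightOneSpectrum (𝓞 ℚ), (Rat.HeightOneSpectrum.primesEquiv v : ℕ) = p :=
    ⟨Rat.HeightOneSpectrum.primesEquiv.symm ⟨p, hpP⟩, by rw [Equiv.apply_symm_apply]⟩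
  have hgoodX : (C • X).HasGoodReductionAtPrime p := by
    subst hv
    rw [hasGoodReductionAtPrime_iff_hasGoodReductionAt_ringOfIntegers v (C • X),
      hasGoodReductionAt_smul_iff_holds v X C]
    exact W.hasGoodReductionAt_quadraticTwist v h2d hΔ
  -- ordinarity: `a_p(C • X) = (d₀/p) a_p(W)` with `(d₀/p) = ±1`
  have hap : (C • X).frobeniusTrace p = legendreSym p d₀ * W.frobeniusTrace p :=
    frobeniusTrace_quadraticTwist_holds W (C • X) d₀ hd₀sq hiso p h2d₀ hΔ
  have hordX : ¬ (p : ℤ) ∣ (C • X).frobeniusTrace p := by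
    rw [hap]
    rcases legendreSym.eq_one_or_neg_one p hd₀p with h1 | h1
    · rw [h1, one_mul]; exact hord
    · rw [h1, neg_one_mul, dvd_neg]; exact hord
  -- surjectivity of `ρ̄_{C • X, p}`
  have hsurjX : (C • X).HasSurjectiveModNGaloisRep p :=
    twistAdmissible_hasSurjectiveModNGaloisRep_smul_quadraticTwist W (by exact_mod_cast hd) C p
      hsurj
  exact ⟨C, hC, hgoodX, hordX, hsurjX⟩

end Summit.BirchSwinnertonDyer.BirchSwinnertonDyer.Theorems

end
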